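import Summits.HodgeConjecture.HodgeConjecture.Theorems.K2LiuLineThetaKernelFrameTransport
import Summits.HodgeConjecture.HodgeConjecture.Theorems.K2LiuLineThetaKernelMirrorInv
import Literature.NumberTheory.K2Lit.DoubledLineThetaKernel
import Mathlib.LinearAlgebra.Matrix.Permutation
import HarnessLib

/-!
# The slot frames of #44∕45R are the letter frame `d_V` up to the coordinate permutation `x = fst ∘ e₁⁻¹`: the permutation isometry, and SLOT 1 read
# on the line `⟨−a′⟩` with `conj` — organ (O44g) of socket #44∕45R (assembly Steps 3, `K2/K2Liu-p03/g3/ROAD-44-45R-Assembly`)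

Track B ∕ hLiu418 = stmt-HodgeConjecture-24832, line `K2_Liu_CurveThetaSigs`, unit U6 ED. 6, socket #44∕45R `sig_K2LiuUndoublingSeparation`;
seat `hodgecm-mathlib-K2Liu-p03` (g3).  After undoubling (★ `K2LiuDoubledKernelAtIota.lineThetaKer_dD_iotaV`) slot 1 is the line-theta kernel at the
frame `F₁ = dD ∘ castAdd`, `F₁ k = d_V (x k) · 1` (`x k = (e₁⁻¹ k).1`, a permutation of `Fin 2` once `n′ = 2`), evaluated at `k₁(g) = reindex e₁ (g ⊗ 1)`.
The permutation matrix `P = permMatrix x` is a rational ISOMETRY `ᵗP · diag F₁ · P = diag d_V` with `P⁻¹ k₁(g) P = g`, so ★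
`K2LiuLineThetaKernelFrameTransport.lineThetaKer_frameTransport` moves slot 1 to the letter frame `d_V`; then ★
`K2LiuLineThetaKernelMirror.conj_lineThetaKer_mk_eq_neg` at `(λ, λ₂) := (lam⁻¹, lam)`, `a := a′` puts it on the line `⟨−a′⟩` at `lam` under a `conj` —
EXACTLY slot 1 of the socket's display.

* §1 the permutation isometry: `formCongr_permMatrix_diagonal_castAdd` (`ᵗ(c̄P)·(1 • diag F₁)·P = diag d_V`) and `adelicIsometryConj_permMatrix_reindexGL`
  (`Ad(P⁻¹ ⊗ 1) k₁(g) = g`), for `e₁ : Fin 2 × Fin 1 ≃ Fin 2` and any `B ∈ GL₂(L)` with matrix `permMatrix x` (Mathlib `Equiv.Perm.permMatrix`);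
* §2 **`exists_slotOne_eq_conj`** — `∃ R` linear with, for all `Φ, g, u` and `u₂ ∈ U(⟨−a′⟩)(𝔸)` with the matrix of `u`:
  `θ^{F₁,⟨a′⟩,lam⁻¹}_{Φ}(mk k₁(g)⁻¹, mk u) = conj θ^{d_V,⟨−a′⟩,lam}_{C(RΦ)}(mk g⁻¹, mk u₂)`.

No definition, no instance, no named fact, no `sorry`; axioms ⊆ {propext, Classical.choice, Quot.sound}.

## References
* [Liu2021] Y. Liu, Camb. J. Math. 9 (2021), Def. 4.11; App. D §D.1 Step 1 (footnote l. 5215), Lemma D.1 (2), Remark 4.4.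
* [HarrisKudlaSweet1996] M. Harris, S. Kudla, W. J. Sweet, J. AMS 9 (1996), §1 Lem. 1.1 p. 953, (1.30).
* [Kudla1994] S. Kudla, Israel J. Math. 87 (1994), §3 Thm. 3.1.
* [PlatonovRapinchuk1994] V. Platonov, A. Rapinchuk, *Algebraic Groups and Number Theory* (1994), §5.1.

HONEST LABEL: HC_CM is proved only modulo the 7 printed citations (2 remaining named inputs: hLiu418 = stmt-HodgeConjecture-24832, h413 =
stmt-HodgeConjecture-24833) until rung 0 closes; this helper moves no counter.
-/

set_option autoImplicit false

set_option linter.dupNamespace false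

noncomputable section

open scoped Classical
open scoped Matrix Kronecker ComplexConjugate
open NumberField IsDedekindDomain
open Literature.RepresentationTheory.HeisenbergGroup
open Literature.NumberTheory.Automorphic
open Literature.NumberTheory.Weil1964
open Literature.NumberTheory.GaloisRepresentations
open Literature.RepresentationTheory.HarrisKudlaSweet1996

namespace Summit.HodgeConjecture.HodgeConjecture.Cruxes.HLiu418.K2LiuSlotOnePermutationFrame

open Literature.NumberTheory.Automorphic.UnitaryGroup
open Literature.NumberTheory.Automorphic.IdeleClassGroup
open Literature.NumberTheory.GelbartRogawski1991 Literature.NumberTheory.GelbartRogawski1991.UnitaryDualPair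
open Literature.NumberTheory.GelbartRogawski1991.GRConstruction
open Literature.NumberTheory.Automorphic.Liu2021 Literature.NumberTheory.Automorphic.Liu2021.Def411WeilCarriers
open Literature.NumberTheory.Automorphic.Liu2021.Def411WeilCarriersDoubling
open Literature.NumberTheory.K2Lit.DoubledLineTheta
open Literature.RepresentationTheory.Liu2021
open Summit.HodgeConjecture.HodgeConjecture.Cruxes.HLiu418.K2LiuConjugateSymplecticInv (IsConjugateSymplectic.inv)
open Summit.HodgeConjecture.HodgeConjecture.Cruxes.HLiu418.K2LiuLineThetaKernelMirror
open Summit.HodgeConjecture.HodgeConjecture.Cruxes.HLiu418.K2LiuLineThetaKernelFrameTransport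

variable (L : Type) [Field L] [NumberField L] [IsCMField L] (e₁ : Fin 2 × Fin 1 ≃ Fin 2)
  (dV : Fin 2 → L) (hdV : ∀ i, IsCMField.complexConj L (dV i) = dV i) (hdV0 : ∀ i, dV i ≠ 0)

/-! ## §1 The permutation isometry `P` of the coordinate change `x = fst ∘ e₁⁻¹` -/

/-- entries of a permutation matrix are fixed by any ring homomorphism (they are `0` or `1`). [folklore] -/
theorem permMatrix_map {R S : Type*} [CommRing R] [CommRing S] (f : R →+* S) {m : Type*} [DecidableEq m] [Fintype m] (σ : Equiv.Perm m) :
    (σ.permMatrix R).map f = σ.permMatrix S := by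
  ext i j
  simp only [Matrix.map_apply, PEquiv.toMatrix_apply, Equiv.toPEquiv_apply, Option.mem_def, Option.some.injEq]
  split_ifs <;> simp

/-- the slot frame: `dD (castAdd 2 k) = d_V (e₁⁻¹ k).1 · 1`. [cite: HarrisKudlaSweet1996, §1 (1.9)] -/
theorem dD_castAdd_apply (k : Fin 2) :
    dD L e₁ dV hdV (fun _ : Fin 1 => (1 : L)) (fun _ => map_one _) (Fin.castAdd 2 k) = dV (e₁.symm k).1 * 1 := by
  simp only [dD, finSumFinEquiv_symm_apply_castAdd, Sum.elim_inl, coe_cmGramEntry]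

/-- **`ᵗ(c̄P) · (1 • diag F₁) · P = diag d_V`** for a matrix `B ∈ GL₂(L)` whose underlying matrix is `permMatrix x`, `x := e₁⁻¹ ≫ fst` (as a permutation of
`Fin 2`), `F₁ = dD ∘ castAdd`: the permutation matrix is a rational isometry from the slot frame to the letter frame (the `hB` of ★
`lineThetaKer_frameTransport`; `B` is kept abstract with its matrix pinned, to stay clear of the `Units`-instance diamond of `permMatrixHom.toHomUnits`).
[cite: PlatonovRapinchuk1994, §5.1] [cite: Liu2021, App. D §D.1 Step 1 (footnote l. 5215)] -/
theorem formCongr_permMatrix_diagonal_castAdd (B : GL (Fin 2) L)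
    (hBval : (B : Matrix (Fin 2) (Fin 2) L) = Equiv.Perm.permMatrix L (e₁.symm.trans (Equiv.prodUnique (Fin 2) (Fin 1)))) :
    formCongr ((IsCMField.complexConj L : L ≃ₐ[Fp L] L) : L →+* L) B
        ((1 : L) • Matrix.diagonal fun i => dD L e₁ dV hdV (fun _ : Fin 1 => (1 : L)) (fun _ => map_one _) (Fin.castAdd 2 i)) =
      Matrix.diagonal dV := by
  rw [formCongr, one_smul, hBval, permMatrix_map, Matrix.transpose_permMatrix, Equiv.Perm.inv_def, Equiv.Perm.permMatrix, Equiv.Perm.permMatrix,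
    PEquiv.toMatrix_toPEquiv_mul, PEquiv.mul_toMatrix_toPEquiv, Matrix.submatrix_submatrix, Function.comp_id, Function.id_comp,
    Matrix.submatrix_diagonal_equiv]
  refine congrArg Matrix.diagonal (funext fun j => ?_)
  simp only [Function.comp_apply, dD_castAdd_apply, Equiv.symm_trans_apply, Equiv.prodUnique_symm_apply, Equiv.symm_symm,
    Equiv.symm_apply_apply, mul_one]

omit [NumberField L] [IsCMField L] in
/-- the inverse of such a `B` has matrix `permMatrix x⁻¹`. [folklore] -/
theorem coe_inv_of_coe_eq_permMatrix (B : GL (Fin 2) L)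
    (hBval : (B : Matrix (Fin 2) (Fin 2) L) = Equiv.Perm.permMatrix L (e₁.symm.trans (Equiv.prodUnique (Fin 2) (Fin 1)))) :
    ((B⁻¹ : GL (Fin 2) L) : Matrix (Fin 2) (Fin 2) L) = Equiv.Perm.permMatrix L (e₁.symm.trans (Equiv.prodUnique (Fin 2) (Fin 1))).symm := by
  rw [Matrix.coe_units_inv, hBval]
  refine Matrix.inv_eq_left_inv ?_
  rw [← Matrix.permMatrix_mul, Equiv.Perm.mul_def, Equiv.symm_trans_self]
  exact Matrix.permMatrix_refl

/-- **`Ad(P⁻¹ ⊗ 1) k₁(g) = g`**: conjugating the block element `k₁(g) = reindex e₁ (g ⊗ 1)` (★ `reindexGL_adelicInl_mem_castAdd`) back by the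
permutation isometry returns `g` (`ᵗP · (g_{x i, x j})_{ij} · P = g`). [cite: Liu2021, §B.3 p. 101] [cite: PlatonovRapinchuk1994, §5.1] -/
theorem adelicIsometryConj_permMatrix_reindexGL (B : GL (Fin 2) L)
    (hBval : (B : Matrix (Fin 2) (Fin 2) L) = Equiv.Perm.permMatrix L (e₁.symm.trans (Equiv.prodUnique (Fin 2) (Fin 1))))
    (g : UnitaryGroup.adelic (Fp L) L (IsCMField.complexConj L) 2 (Matrix.diagonal dV))
    (hk : UnitaryGroup.reindexGL e₁
        ((UnitaryGroup.adelicInl (Fp L) L (IsCMField.complexConj L) 2 1 (Matrix.diagonal dV) (Matrix.diagonal fun _ : Fin 1 => (1 : L)) g :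
          UnitaryGroup.adelicPair (Fp L) L (IsCMField.complexConj L) 2 1 (Matrix.diagonal dV) (Matrix.diagonal fun _ : Fin 1 => (1 : L))) :
            GL (Fin 2 × Fin 1) (AdeleRing (𝓞 L) L)) ∈
      UnitaryGroup.adelic (Fp L) L (IsCMField.complexConj L) 2
        (Matrix.diagonal fun i => dD L e₁ dV hdV (fun _ : Fin 1 => (1 : L)) (fun _ => map_one _) (Fin.castAdd 2 i))) :
    adelicIsometryConj (Fp L) L (IsCMField.complexConj L) 2 (aOfB L B)
        (aOfB_isometry L dV (fun i => dD L e₁ dV hdV (fun _ : Fin 1 => (1 : L)) (fun _ => map_one _) (Fin.castAdd 2 i)) B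
          (formCongr_permMatrix_diagonal_castAdd L e₁ dV hdV B hBval)) ⟨_, hk⟩ = g := by
  refine Subtype.ext (Units.ext ?_)
  -- the matrices of `aOfB B = B⁻¹ ⊗ 1` and of its inverse: the permutation matrices of `x⁻¹` and `x` over the adeles
  have ha : ((aOfB L B : GL (Fin 2) (AdeleRing (𝓞 L) L)) : Matrix (Fin 2) (Fin 2) (AdeleRing (𝓞 L) L)) =
      Equiv.Perm.permMatrix (AdeleRing (𝓞 L) L) (e₁.symm.trans (Equiv.prodUnique (Fin 2) (Fin 1))).symm := by
    rw [coe_aOfB, coe_inv_of_coe_eq_permMatrix L e₁ B hBval, permMatrix_map]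
  have ha' : (((aOfB L B)⁻¹ : GL (Fin 2) (AdeleRing (𝓞 L) L)) : Matrix (Fin 2) (Fin 2) (AdeleRing (𝓞 L) L)) =
      Equiv.Perm.permMatrix (AdeleRing (𝓞 L) L) (e₁.symm.trans (Equiv.prodUnique (Fin 2) (Fin 1))) := by
    rw [aOfB, ← map_inv, inv_inv]
    change ((B : GL (Fin 2) L) : Matrix (Fin 2) (Fin 2) L).map (algebraMap L (AdeleRing (𝓞 L) L)) = _
    rw [hBval, permMatrix_map]
  rw [UnitaryGroup.coe_adelicIsometryConj, Units.val_mul, Units.val_mul, ha, ha']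
  change Equiv.Perm.permMatrix (AdeleRing (𝓞 L) L) (e₁.symm.trans (Equiv.prodUnique (Fin 2) (Fin 1))).symm *
      Matrix.reindex e₁ e₁ (((g : GL (Fin 2) (AdeleRing (𝓞 L) L)) : Matrix (Fin 2) (Fin 2) (AdeleRing (𝓞 L) L)) ⊗ₖ
        (1 : Matrix (Fin 1) (Fin 1) (AdeleRing (𝓞 L) L))) *
      Equiv.Perm.permMatrix (AdeleRing (𝓞 L) L) (e₁.symm.trans (Equiv.prodUnique (Fin 2) (Fin 1))) = _
  rw [Equiv.Perm.permMatrix, Equiv.Perm.permMatrix, PEquiv.toMatrix_toPEquiv_mul, PEquiv.mul_toMatrix_toPEquiv, Matrix.submatrix_submatrix,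
    Function.comp_id, Function.id_comp, Matrix.reindex_apply, Matrix.submatrix_submatrix]
  ext i j
  simp only [Matrix.submatrix_apply, Function.comp_apply, Equiv.symm_trans_apply, Equiv.symm_symm, Equiv.prodUnique_symm_apply,
    Equiv.symm_apply_apply, Matrix.kroneckerMap_apply, Matrix.one_apply_eq, mul_one]

/-! ## §2 Slot 1 of #44∕45R: from the slot frame `dD ∘ castAdd` at `⟨a′⟩, λ̃⁻¹` to the letter frame `d_V` at `⟨−a′⟩, λ̃` under `conj` -/

/-- **SLOT 1.**  For `e₁ : Fin 2 × Fin 1 ≃ Fin 2`, a `B ∈ GL₂(L)` with matrix `permMatrix (e₁⁻¹ ≫ fst)`, a conjugate-symplectic `λ` and a line `a′`: there is a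
ℂ-linear `R` on `𝒮(𝔸^2)` (Weil's Θ-fixing lift of the permutation isometry, ★ `lineThetaKer_frameTransport`) such that for all `Φ`, `g ∈ U(diag d_V)(𝔸)`,
`u ∈ U(⟨a′⟩)(𝔸)` and `u₂ ∈ U(⟨−a′⟩)(𝔸)` with the same matrix,
`θ^{dD∘castAdd, ⟨a′⟩, λ⁻¹}_{Φ}(mk k₁(g)⁻¹, mk u) = conj θ^{d_V, ⟨−a′⟩, λ}_{C(RΦ)}(mk g⁻¹, mk u₂)`, `k₁(g) = reindex e₁ (g ⊗ 1)` —
the frame transport followed by ★ `conj_lineThetaKer_mk_eq_neg` at `(λ, λ₂) := (lam⁻¹, lam)`, `a := a′` (NO double negation: `⟨−a′⟩` is the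
display's line, `C(RΦ)` its `Φ₁`). [cite: Liu2021, App. D Lemma D.1 (2), Remark 4.4; §D.1 Step 1 (footnote l. 5215)] [cite: HarrisKudlaSweet1996, §1 Lem. 1.1 p. 953]
[cite: Kudla1994, §3 Thm. 3.1] -/
theorem exists_slotOne_eq_conj (lam : Literature.NumberTheory.Automorphic.IdeleClassGroup L →ₜ* Circle) (hlam : IsConjugateSymplectic L lam)
    (a' : (Fp L)ˣ) (B : GL (Fin 2) L)
    (hBval : (B : Matrix (Fin 2) (Fin 2) L) = Equiv.Perm.permMatrix L (e₁.symm.trans (Equiv.prodUnique (Fin 2) (Fin 1))))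
    (hρF : HasThetaMajorants fun
      (p : ↥(UnitaryGroup.adelic (Fp L) L (IsCMField.complexConj L) 2
          (Matrix.diagonal fun i => dD L e₁ dV hdV (fun _ : Fin 1 => (1 : L)) (fun _ => map_one _) (Fin.castAdd 2 i))) ×
        ↥(UnitaryGroup.adelic (Fp L) L (IsCMField.complexConj L) 1 (JW (Fp L) L a')))
      (Φ : piSchwartzBruhat (Fp L) (Fin 2)) =>
        pairRep (Fp L) L (IsCMField.complexConj L) 2 1 e₁
          (Matrix.diagonal fun i => dD L e₁ dV hdV (fun _ : Fin 1 => (1 : L)) (fun _ => map_one _) (Fin.castAdd 2 i)) (JW (Fp L) L a')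
          (chiSplittingLine L e₁ (fun i => dD L e₁ dV hdV (fun _ : Fin 1 => (1 : L)) (fun _ => map_one _) (Fin.castAdd 2 i))
            (fun i => dD_conj L e₁ dV hdV (fun _ : Fin 1 => (1 : L)) (fun _ => map_one _) (Fin.castAdd 2 i))
            (fun i => dD_ne_zero L e₁ dV hdV (fun _ : Fin 1 => (1 : L)) (fun _ => map_one _) hdV0 (fun _ => one_ne_zero) (Fin.castAdd 2 i))
            (toHeckeCharacter L lam⁻¹) (isUnitary_toHeckeCharacter L lam⁻¹)
            ((isOscillatorChar_toHeckeCharacter_iff lam⁻¹).mpr (IsConjugateSymplectic.inv hlam)) (TW (Fp L) a')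
            (isUnit_det_TW (Fp L) a') (JW (Fp L) L a') (JW_eq (Fp L) L a'))
          p Φ)
    (hρ₁ : HasThetaMajorants fun
      (p : ↥(UnitaryGroup.adelic (Fp L) L (IsCMField.complexConj L) 2 (Matrix.diagonal dV)) ×
        ↥(UnitaryGroup.adelic (Fp L) L (IsCMField.complexConj L) 1 (JW (Fp L) L a')))
      (Φ : piSchwartzBruhat (Fp L) (Fin 2)) =>
        pairRep (Fp L) L (IsCMField.complexConj L) 2 1 e₁ (Matrix.diagonal dV) (JW (Fp L) L a')
          (chiSplittingLine L e₁ dV hdV hdV0 (toHeckeCharacter L lam⁻¹) (isUnitary_toHeckeCharacter L lam⁻¹)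
            ((isOscillatorChar_toHeckeCharacter_iff lam⁻¹).mpr (IsConjugateSymplectic.inv hlam)) (TW (Fp L) a')
            (isUnit_det_TW (Fp L) a') (JW (Fp L) L a') (JW_eq (Fp L) L a'))
          p Φ)
    (hρ₂ : HasThetaMajorants fun
      (p : ↥(UnitaryGroup.adelic (Fp L) L (IsCMField.complexConj L) 2 (Matrix.diagonal dV)) ×
        ↥(UnitaryGroup.adelic (Fp L) L (IsCMField.complexConj L) 1 (JW (Fp L) L (-a'))))
      (Φ : piSchwartzBruhat (Fp L) (Fin 2)) =>
        pairRep (Fp L) L (IsCMField.complexConj L) 2 1 e₁ (Matrix.diagonal dV) (JW (Fp L) L (-a'))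
          (chiSplittingLine L e₁ dV hdV hdV0 (toHeckeCharacter L lam) (isUnitary_toHeckeCharacter L lam)
            ((isOscillatorChar_toHeckeCharacter_iff lam).mpr hlam) (TW (Fp L) (-a')) (isUnit_det_TW (Fp L) (-a')) (JW (Fp L) L (-a'))
            (JW_eq (Fp L) L (-a')))
          p Φ) :
    ∃ R : piSchwartzBruhat (Fp L) (Fin 2) →ₗ[ℂ] piSchwartzBruhat (Fp L) (Fin 2),
      ∀ (Φ : piSchwartzBruhat (Fp L) (Fin 2)) (g : UnitaryGroup.adelic (Fp L) L (IsCMField.complexConj L) 2 (Matrix.diagonal dV))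
        (u : UnitaryGroup.adelic (Fp L) L (IsCMField.complexConj L) 1 (JW (Fp L) L a'))
        (u₂ : UnitaryGroup.adelic (Fp L) L (IsCMField.complexConj L) 1 (JW (Fp L) L (-a')))
        (_hu : (u₂ : GL (Fin 1) (AdeleRing (𝓞 L) L)) = (u : GL (Fin 1) (AdeleRing (𝓞 L) L)))
        (hk : UnitaryGroup.reindexGL e₁
          ((UnitaryGroup.adelicInl (Fp L) L (IsCMField.complexConj L) 2 1 (Matrix.diagonal dV) (Matrix.diagonal fun _ : Fin 1 => (1 : L)) g :
            UnitaryGroup.adelicPair (Fp L) L (IsCMField.complexConj L) 2 1 (Matrix.diagonal dV) (Matrix.diagonal fun _ : Fin 1 => (1 : L))) :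
              GL (Fin 2 × Fin 1) (AdeleRing (𝓞 L) L)) ∈
          UnitaryGroup.adelic (Fp L) L (IsCMField.complexConj L) 2
            (Matrix.diagonal fun i => dD L e₁ dV hdV (fun _ : Fin 1 => (1 : L)) (fun _ => map_one _) (Fin.castAdd 2 i))),
        (lineThetaKernelDatum L 2 e₁ (fun i => dD L e₁ dV hdV (fun _ : Fin 1 => (1 : L)) (fun _ => map_one _) (Fin.castAdd 2 i))
            (fun i => dD_conj L e₁ dV hdV (fun _ : Fin 1 => (1 : L)) (fun _ => map_one _) (Fin.castAdd 2 i))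
            (fun i => dD_ne_zero L e₁ dV hdV (fun _ : Fin 1 => (1 : L)) (fun _ => map_one _) hdV0 (fun _ => one_ne_zero) (Fin.castAdd 2 i))
            lam⁻¹ (IsConjugateSymplectic.inv hlam) a' hρF).thetaKer Φ
            (QuotientGroup.mk (⟨_, hk⟩ : UnitaryGroup.adelic (Fp L) L (IsCMField.complexConj L) 2
              (Matrix.diagonal fun i => dD L e₁ dV hdV (fun _ : Fin 1 => (1 : L)) (fun _ => map_one _) (Fin.castAdd 2 i)))⁻¹,
              QuotientGroup.mk u) =
          conj ((lineThetaKernelDatum L 2 e₁ dV hdV hdV0 lam hlam (-a') hρ₂).thetaKer (piSchwartzBruhatConj (Fp L) (Fin 2) (R Φ))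
            (QuotientGroup.mk g⁻¹, QuotientGroup.mk u₂)) := by
  obtain ⟨R, hR⟩ := lineThetaKer_frameTransport L 2 e₁ (fun i => dD L e₁ dV hdV (fun _ : Fin 1 => (1 : L)) (fun _ => map_one _) (Fin.castAdd 2 i))
    (fun i => dD_conj L e₁ dV hdV (fun _ : Fin 1 => (1 : L)) (fun _ => map_one _) (Fin.castAdd 2 i))
    (fun i => dD_ne_zero L e₁ dV hdV (fun _ : Fin 1 => (1 : L)) (fun _ => map_one _) hdV0 (fun _ => one_ne_zero) (Fin.castAdd 2 i))
    dV hdV hdV0 lam⁻¹ (IsConjugateSymplectic.inv hlam) a' B (formCongr_permMatrix_diagonal_castAdd L e₁ dV hdV B hBval) hρF hρ₁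
  refine ⟨R, fun Φ g u u₂ hu hk => ?_⟩
  -- `Ad(B⁻¹ ⊗ 1) k₁(g)⁻¹ = g⁻¹`
  have hAd : adelicIsometryConj (Fp L) L (IsCMField.complexConj L) 2 (aOfB L B)
      (aOfB_isometry L dV (fun i => dD L e₁ dV hdV (fun _ : Fin 1 => (1 : L)) (fun _ => map_one _) (Fin.castAdd 2 i)) B
        (formCongr_permMatrix_diagonal_castAdd L e₁ dV hdV B hBval))
      (⟨_, hk⟩ : UnitaryGroup.adelic (Fp L) L (IsCMField.complexConj L) 2
        (Matrix.diagonal fun i => dD L e₁ dV hdV (fun _ : Fin 1 => (1 : L)) (fun _ => map_one _) (Fin.castAdd 2 i)))⁻¹ = g⁻¹ := by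
    rw [map_inv, adelicIsometryConj_permMatrix_reindexGL L e₁ dV hdV B hBval g hk]
  have h1 := (hR Φ ((⟨_, hk⟩ : UnitaryGroup.adelic (Fp L) L (IsCMField.complexConj L) 2
      (Matrix.diagonal fun i => dD L e₁ dV hdV (fun _ : Fin 1 => (1 : L)) (fun _ => map_one _) (Fin.castAdd 2 i)))⁻¹) u).trans
    (congrArg (fun z => (lineThetaKernelDatum L 2 e₁ dV hdV hdV0 lam⁻¹ (IsConjugateSymplectic.inv hlam) a' hρ₁).thetaKer (R Φ)
      (QuotientGroup.mk z, QuotientGroup.mk u)) hAd)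
  -- the mirror at `(λ, λ₂) := (lam⁻¹, lam)`, `a := a′`
  have hinv : toHeckeCharacter L lam = (toHeckeCharacter L lam⁻¹)⁻¹ := by
    rw [toHeckeCharacter_inv', inv_inv]
  have h2 := conj_lineThetaKer_mk_eq_neg L 2 e₁ dV hdV hdV0 lam⁻¹ lam (IsConjugateSymplectic.inv hlam) hlam hinv a' hρ₁ hρ₂ (R Φ) g⁻¹ u u₂ hu
  exact h1.trans ((starRingEnd_self_apply _).symm.trans (congrArg conj h2))

end Summit.HodgeConjecture.HodgeConjecture.Cruxes.HLiu418.K2LiuSlotOnePermutationFrame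

end
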